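import Summits.BirchSwinnertonDyer.BirchSwinnertonDyer.Theorems.KolyvaginDepthDoorDefs
import Summits.BirchSwinnertonDyer.BirchSwinnertonDyer.Theorems.KolyvaginDepthDoorKolyvaginDepthSupplyDoorOfDatum
import HarnessLib

/-!
# Route `KolyvaginDepthDoor` — the route from the DATUM form of the crux: `KolyvaginDepthSupplyDatum` +
# five S/M McCallum–Gross leaves ⟹ X1 on non-CM curves ⟹ BSD-rank given the other items; and
# `KolyvaginDepthSupplySystem ⟹ KolyvaginDepthSupplyDatum` (crux `KolyvaginDepthSupply`,
# stmt-BirchSwinnertonDyer-21765)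

Helper file (`--supports stmt-BirchSwinnertonDyer-21765 --as helper`); it closes nothing and BSD is
not proved by it. PLANNER-FACING: g6's `…KolyvaginDepthSupplySystemDoor` showed that the route's assembly
can trade the crux `KolyvaginDepthSupply` and the XL support item `KolyvaginStructure` for the restated
crux `KolyvaginDepthSupplySystem` + five S/M named leaves. That restatement still carries a COMPATIBLE
SYSTEM `d : ∀ n : ℕ, KolyvaginHeegnerData Dt β ι n` with four coherence clauses — a binder no curve can
be shown to satisfy (no datum is known at level `0`). With the compatible system now a THEOREM on the
good levels (`exists_kolyvaginHeegnerSystem_extending`, file `…KolyvaginHeegnerSystem`, UNCONDITIONAL),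
the DATUM form `KolyvaginDepthSupplyDatum` (file `…KolyvaginDepthDoorDefs`: ONE datum at ONE level,
no system, no minimality, no twist-rank clause) does the same job:

* `kolyvaginDepthSupplyDatum_of_kolyvaginDepthSupplySystem` — KDS_system ⟹ KDS_datum (take `d n₁`);
* `shaCorank_eq_zero_nonCM_of_kolyvaginDepthSupplyDatum` — KDS_datum + five leaves ⟹ X1 on non-CM
  curves (and the crux's first rank clause at the witness, `Ш(E/ℚ)[p] = 0`, `#Sel_p(E/ℚ) = p^{rank}`),
  via the door of a datum `shaCorank_eq_zero_of_kolyvaginClass_ne_zero_of_rank_le_of_datum`;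
* `shaCorankZeroAtOnePrime_of_kolyvaginDepthSupplyDatum` — with the CM residual: X1 for EVERY `E/ℚ`
  (the body of `KatoTransfer`'s `ShaCorankZeroAtOnePrime`, stmt-BirchSwinnertonDyer-18411);
* `bsd_of_kolyvaginDepthSupplyDatum` — with `ShaCorankZeroAtOnePrimeOfCM`, `AnalyticRankLeSelmerCorank`,
  `PadicOrderLeAnalyticRankAtOnePrime`, `KatoRankBound` (verbatim): `BirchSwinnertonDyer`, through g6's
  `bsd_of_kolyvaginDepthSupplySystem`-shaped assembly (here: through X1 and the route's two legs, by
  `bsd_of_shaCorankZeroAtOnePrime`-style reuse of g6's theorem with the kernel swapped).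

CONDITIONAL on the displayed hypotheses (all open / named); nothing is discharged here; BSD is NOT proved
by this file. bears_on: the route's ledger economics (crux restatement; support item #9
`KolyvaginStructure`, XL, no longer needed).

References: [Kolyvagin1991MathAnn] Thm. 2.3; [GrossLMS1991] §§3–5, §10; [McCallumLMS1991] §§2–5;
[Kato2004Asterisque] Thm. 17.4; [SilvermanAEC2009] X.4.2.
-/

set_option linter.dupNamespace false

noncomputable section

open scoped Classical

namespace Summit.BirchSwinnertonDyer.BirchSwinnertonDyer.Theorems.KolyvaginDepthDoor

open Literature Literature.NumberTheory.EllipticCurves Literature.NumberTheory.EllipticCurves.ModularForms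
  Literature.NumberTheory.EllipticCurves.McCallum1991 WeierstrassCurve NumberField IsDedekindDomain
open Summit.BirchSwinnertonDyer.BirchSwinnertonDyer.Theses.KolyvaginDepthDoor

/-- **`KolyvaginDepthSupplySystem ⟹ KolyvaginDepthSupplyDatum`**: the datum form is implied by the
system form (take the datum `d n₁` of the system; the compatibility clauses are simply dropped).
[cite: Kolyvagin1991MathAnn, §1] -/
theorem kolyvaginDepthSupplyDatum_of_kolyvaginDepthSupplySystem (hS : KolyvaginDepthSupplySystem) :
    KolyvaginDepthSupplyDatum := by
  intro W _ _ hcm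
  obtain ⟨p, hp, h5, hgood, hord, htower, K, iF, iN, hK, hD3, hD4, iNZ, hH, Dt, β, ι, d, -, -, -,
    -, n₁, hn₁, hk₁, hne, hrank⟩ := hS W hcm
  exact ⟨p, hp, h5, hgood, hord, htower, K, iF, iN, hK, hD3, hD4, iNZ, hH, Dt, β, ι, n₁, d n₁, hn₁, hk₁,
    hne, hrank⟩

/-- **KDS_datum + five leaves ⟹ X1 on non-CM curves.** Granted `KolyvaginDepthSupplyDatum` and the
five named McCallum/Gross facts: every non-CM globally minimal elliptic `E/ℚ` has a prime `p ≥ 5` of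
good ordinary reduction with `corank_{ℤ_p} Ш(E/ℚ)[p^∞] = 0`; moreover the witness `n₁` satisfies the
crux's first rank clause `#{q ∣ n₁} + 1 = rank E(ℚ) > rank E^{(d_K)}(ℚ)`, and `Ш(E/ℚ)[p] = 0`,
`#Sel^(p)(E/ℚ) = p^{rank}`. Proof: `shaCorank_eq_zero_of_kolyvaginClass_ne_zero_of_rank_le_of_datum`
(the door of a datum at depth `ν(n₁)`: the datum is extended to a compatible system by
`exists_kolyvaginHeegnerSystem_extending`; complex conjugation from `exists_conj_of_isImaginaryQuadratic`).
NO Kolyvagin Thm. 4, NO twist point, NO system. CONDITIONAL on `hS` and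
the five facts; BSD is not proved by it. [cite: Kolyvagin1991MathAnn, Thm. 2.3]
[cite: GrossLMS1991, §5 (5.1) and §10] [cite: McCallumLMS1991, §§2–5] -/
theorem shaCorank_eq_zero_nonCM_of_kolyvaginDepthSupplyDatum (hS : KolyvaginDepthSupplyDatum)
    (h54 : sign_conjAct_kolyvaginClass) (h43 : lemma43_kolyvaginClass_mem_selmerLocalKer)
    (h44 : prop44_localOrder_kolyvaginClass_mul_eq) (h53 : lemma53_selmer_eigen_dependent_at)
    (h22 : prop22_reciprocity_eigen_finset)
    (W : WeierstrassCurve ℚ) [W.IsElliptic] [W.IsGloballyMinimal] (hcm : ¬ W.HasCM) :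
    ∃ (p : ℕ) (_ : Fact p.Prime), 5 ≤ p ∧ W.HasGoodReductionAtPrime p ∧
      ¬ (p : ℤ) ∣ W.frobeniusTrace p ∧ W.shaCorank p = 0 ∧
      ∃ (K : Type) (_ : Field K) (_ : NumberField K) (n₁ : ℕ), IsImaginaryQuadratic K ∧
        n₁.primeFactors.card + 1 = W.mordellWeilRank ∧
        (W.quadraticTwist (NumberField.discr K : ℚ)).mordellWeilRank < W.mordellWeilRank ∧
        W.sha ⊓ AddSubgroup.torsionBy W.galH1 ((p ^ 1 : ℕ) : ℤ) = ⊥ ∧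
        Nat.card ↥(selmerGroup W ((p ^ 1 : ℕ) : ℤ)) = p ^ W.mordellWeilRank := by
  obtain ⟨p, hp, h5, hgood, hord, htower, K, iF, iN, hK, hD3, hD4, iNZ, hH, Dt, β, ι, n₁, d, hn₁, hk₁,
    hne, hrank⟩ := hS W hcm
  haveI := hp
  haveI := iNZ
  have hp2 : p ≠ 2 := by omega
  obtain ⟨c, hc, hcc⟩ := exists_conj_of_isImaginaryQuadratic K hK
  obtain ⟨hsha, hr, hr', -, hbot, hSel⟩ :=
    shaCorank_eq_zero_of_kolyvaginClass_ne_zero_of_rank_le_of_datum h54 h43 h44 h53 h22 hcm hK hD3 hD4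
      hH p hp2 htower c hc hcc hn₁ hk₁ d hne hrank
  refine ⟨p, hp, h5, hgood, hord, hsha, K, iF, iN, n₁, hK, hr.symm, by omega, hbot, ?_⟩
  rw [hSel, hr]

/-- **KDS_datum + five leaves + the CM residual ⟹ X1 for every elliptic curve over `ℚ`**: every
globally minimal elliptic `E/ℚ` has a prime `p ≥ 5` of good ordinary reduction with
`corank_{ℤ_p} Ш(E/ℚ)[p^∞] = 0` — literally the body of `KatoTransfer`'s crux `ShaCorankZeroAtOnePrime`
(stmt-BirchSwinnertonDyer-18411) and the kernel `hX1` of this route's `closes`, obtained WITHOUT the XL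
support item `KolyvaginStructure`. CONDITIONAL on `hS`, the five facts and `hCM`; BSD is not proved by
it. [cite: Kolyvagin1991MathAnn, Thm. 2.3] [cite: McCallumLMS1991, §§2–5] -/
theorem shaCorankZeroAtOnePrime_of_kolyvaginDepthSupplyDatum (hS : KolyvaginDepthSupplyDatum)
    (h54 : sign_conjAct_kolyvaginClass) (h43 : lemma43_kolyvaginClass_mem_selmerLocalKer)
    (h44 : prop44_localOrder_kolyvaginClass_mul_eq) (h53 : lemma53_selmer_eigen_dependent_at)
    (h22 : prop22_reciprocity_eigen_finset) (hCM : ShaCorankZeroAtOnePrimeOfCM) :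
    ∀ (W : WeierstrassCurve ℚ) [W.IsElliptic] [W.IsGloballyMinimal],
      ∃ (p : ℕ) (_ : Fact p.Prime), 5 ≤ p ∧ W.HasGoodReductionAtPrime p ∧
        ¬ (p : ℤ) ∣ W.frobeniusTrace p ∧ W.shaCorank p = 0 := by
  intro W _ _
  by_cases hcm : W.HasCM
  · exact hCM W hcm
  · obtain ⟨p, hp, h5, hgood, hord, hsha, -⟩ :=
      shaCorank_eq_zero_nonCM_of_kolyvaginDepthSupplyDatum hS h54 h43 h44 h53 h22 W hcm
    exact ⟨p, hp, h5, hgood, hord, hsha⟩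

/-- **The route from the datum form: KDS_datum + five leaves + X1_CM + X2 + X3 + Kato ⟹ BSD-rank.**
Hypotheses: `KolyvaginDepthSupplyDatum`, the five named McCallum/Gross facts, and the
route's items `ShaCorankZeroAtOnePrimeOfCM`, `AnalyticRankLeSelmerCorank`,
`PadicOrderLeAnalyticRankAtOnePrime`, `KatoRankBound` VERBATIM; conclusion `_root_.BirchSwinnertonDyer`.
The kernel is `shaCorankZeroAtOnePrime_of_kolyvaginDepthSupplyDatum`; the transport of rank /
`L`-function along a global minimal model and the two legs (X1 + Kummer + X2 ⟹ `r_an ≤ r_MW`; X3 + Kato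
⟹ `r_MW ≤ r_an`) are copied verbatim from the route's certified deciding theorem `closes`. Every
hypothesis is OPEN or a named fact; NOTHING is discharged and BSD is NOT proved by this.
[cite: Kato2004Asterisque, Thm. 17.4] [cite: Kolyvagin1991MathAnn, Thm. 2.3]
[cite: SilvermanAEC2009, Thm X.4.2] -/
theorem bsd_of_kolyvaginDepthSupplyDatum (hS : KolyvaginDepthSupplyDatum)
    (h54 : sign_conjAct_kolyvaginClass) (h43 : lemma43_kolyvaginClass_mem_selmerLocalKer)
    (h44 : prop44_localOrder_kolyvaginClass_mul_eq) (h53 : lemma53_selmer_eigen_dependent_at)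
    (h22 : prop22_reciprocity_eigen_finset) (hCM : ShaCorankZeroAtOnePrimeOfCM)
    (hX2 : AnalyticRankLeSelmerCorank) (hX3 : PadicOrderLeAnalyticRankAtOnePrime)
    (hK : KatoRankBound) : _root_.BirchSwinnertonDyer := by
  have hX1 := shaCorankZeroAtOnePrime_of_kolyvaginDepthSupplyDatum hS h54 h43 h44 h53 h22 hCM
  -- (T1) the Mordell–Weil rank is an isomorphism invariant (AEC III.3.1(b); `VariableChangePoints`)
  have hMW : ∀ (W : WeierstrassCurve ℚ) (C : WeierstrassCurve.VariableChange ℚ),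
      (C • W).mordellWeilRank = W.mordellWeilRank := fun W C =>
    @WeierstrassCurve.VariableChange.finrank_point_variableChange ℚ _ W C (Classical.decEq ℚ)
  -- (T2) the local Euler factor over the fraction field of a DVR is an isomorphism invariant
  have hloc : ∀ (R : Type) [CommRing R] [IsDomain R] [IsDiscreteValuationRing R]
      (K : Type) [Field K] [Algebra R K] [IsFractionRing R K]
      (W : WeierstrassCurve K) [W.IsElliptic] (C : WeierstrassCurve.VariableChange K),
      (C • W).localEulerFactor R = W.localEulerFactor R := by
    intro R _ _ _ K _ _ _ W _ C
    obtain ⟨D, hD⟩ : ∃ D : WeierstrassCurve.VariableChange K,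
        (C • W).minimal R = D • W.minimal R :=
      ⟨((C • W).exists_isMinimal R).choose * C * ((W.exists_isMinimal R).choose)⁻¹, by
        rw [WeierstrassCurve.minimal, WeierstrassCurve.minimal, mul_smul, mul_smul, inv_smul_smul]⟩
    haveI hE : (W.minimal R).IsElliptic := by rw [WeierstrassCurve.minimal]; infer_instance
    have hΔ : (W.minimal R).Δ ≠ 0 := (W.minimal R).isUnit_Δ.ne_zero
    have hgood : ((C • W).minimal R).HasGoodReduction R ↔ (W.minimal R).HasGoodReduction R := by
      rw [WeierstrassCurve.hasGoodReduction_iff, WeierstrassCurve.hasGoodReduction_iff,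
        WeierstrassCurve.valuation_Δ_eq_of_isMinimal_of_eq_smul R hD]
      exact and_congr_left' ⟨fun _ => inferInstance, fun _ => inferInstance⟩
    have hcard : Nat.card (((C • W).minimal R).reduction R).toAffine.Point =
        Nat.card ((W.minimal R).reduction R).toAffine.Point := by
      obtain ⟨E, hE⟩ := WeierstrassCurve.exists_reduction_eq_smul R hD hΔ
      rw [hE]
      exact WeierstrassCurve.natCard_point_smul _ _
    have hpoly : (C • W).localPolynomial R = W.localPolynomial R := by
      classical
      unfold WeierstrassCurve.localPolynomial
      simp only [hgood, hcard,
        WeierstrassCurve.hasSplitMultiplicativeReduction_iff_of_isMinimal_of_eq_smul R hD hΔ,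
        WeierstrassCurve.hasMultiplicativeReduction_iff_of_isMinimal_of_eq_smul R hD hΔ]
    simp only [WeierstrassCurve.localEulerFactor, WeierstrassCurve.localPowerSeries, hpoly]
  -- (T3) hence the analytic rank `ord_{s=1} L(E,s)` is an isomorphism invariant (AEC App. C §16)
  have hAn : ∀ (W : WeierstrassCurve ℚ) [W.IsElliptic] (C : WeierstrassCurve.VariableChange ℚ),
      (C • W).analyticRank = W.analyticRank := by
    intro W _ C
    have hL : (C • W).LFunction = W.LFunction := by
      unfold WeierstrassCurve.LFunction
      congr 1
      funext v
      simp only [WeierstrassCurve.baseChange, ← WeierstrassCurve.map_variableChange]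
      exact hloc _ _ _ _
    have hLS : (C • W).LSeries = W.LSeries := by
      funext s
      simp only [WeierstrassCurve.LSeries, hL]
    have hEC : (C • W).entireContinuations = W.entireContinuations := by
      simp only [WeierstrassCurve.entireContinuations, hLS]
    have hEL : (C • W).entireLFunction = W.entireLFunction := by
      unfold WeierstrassCurve.entireLFunction
      rw [hEC, hLS]
    simp only [WeierstrassCurve.analyticRank, hEL]
  -- the two legs on a global minimal model `C • W` of an arbitrary elliptic `W`
  intro W hW
  obtain ⟨C, hC⟩ := WeierstrassCurve.hasGlobalMinimalModel_rat_holds W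
  -- leg 1 (lower bound r_an ≤ r_MW): X1 at p₁, the Kummer identity, X2 at p₁
  have hLB : (C • W).analyticRank ≤ (C • W).mordellWeilRank := by
    obtain ⟨p, hp, h5, hgood, hord, hsha⟩ := hX1 (C • W)
    have hid : (C • W).selmerCorank p = (C • W).mordellWeilRank + (C • W).shaCorank p :=
      WeierstrassCurve.selmerCorank_eq_mordellWeilRank_add_holds (C • W) p
    have h2 := hX2 (C • W) p h5 hgood hord
    omega
  -- leg 2 (upper bound r_MW ≤ r_an): X3 at (p₂, f), the Kato side at (p₂, f)
  have hUB : (C • W).mordellWeilRank ≤ (C • W).analyticRank := by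
    obtain ⟨p, hp, h5, hgood, hord, N, hN, f, hf, hle⟩ := hX3 (C • W)
    have hp2 : p ≠ 2 := by omega
    have hordAt : Literature.NumberTheory.EllipticCurves.IsOrdinaryAt (C • W) p := ⟨hgood, hord⟩
    have hk := hK (C • W) p hp2 hordAt f hf
    exact_mod_cast hk.trans hle
  have h := le_antisymm hLB hUB
  rw [hAn W C, hMW W C] at h
  exact h

end Summit.BirchSwinnertonDyer.BirchSwinnertonDyer.Theorems.KolyvaginDepthDoor

end
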